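import Summits.QuantumFields.BalabanUV.Beta.FP.TorusCompositeCovariance
import Summits.QuantumFields.BalabanUV.Beta.FP.TorusCompositeObjectsG
import Summits.QuantumFields.BalabanUV.Beta.FP.TorusSymGaugeCovariance

/-!
# `BalabanUV.Beta.FP.TorusCompositeCovarianceSym` — road «FP» for binder row D1, ROUTE T, (β1) RE-BASING (ROW RULING R-D1-g52-1 (3)(c) ∕ the OWNER's
# R-FP-69 [A] «`TorusCompositeCovariance.{compRows_mul_towerGen_succ, Qtop_mul_smul_tgrad_res}` passes → leaf-02»): **(COV-m) ORDER 0 FOR THE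
# (0.4)-SYMMETRISED COMPOSITE TOWER — leaf-06's `compRowsSym … (n+1)` against the tower generator matrix `towerGen … (n+1)` AT THE CENTRED ROOT LIST:
# `Q₁₀ · W₀ = [σ_{n+1} • D̄ | 0]`, and the top step's `Q₂₀ · (σ • D̄) = 0`** — the `hc0 ∕ d0` binders of the OWNER's `-Sym` door files
# (`NestedStepLawTorusCompositeSym` ∕ `…OneShotTopSym`) and of leaf-06's G-1 §2 ∕ G-2 §2, by induction on the depth over leaf-02 g21's one-step sym MASTER identity

WHY.  The rooted file `TorusCompositeCovariance` (leaf-02 g21) proves `c0 ∕ d0` for `compRows` (one-step rows `Qstep Lc M ℓ r`, kernel root = comb root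
`rs k` at every storey).  The (β1) ruling re-bases the tower on an1's (0.4)-SYMMETRISED one-step rows — leaf-06 G-0's `QstepSym Lc M ℓ` (the periodised
shifted straight spread `bhKStepSh d Lc (Dsh Lc) ℓ`, ROOT-FREE: its kernel is centred at `ρ_c = ctr (d+1) Lc = toSite (ctrOff (d+1) Lc)`) and
`compRowsSym Lc M lev rs n := compRowsG Lc (QSym Lc) M lev rs n` (`QSym` IGNORES the root slot).  The sym one-step (C1) kills the fine torus's gauge modes
ONLY at the residual parameters of the CENTRED comb (g21 `TorusSymGaugeCovariance.torus_sym_cov₁`; at a centred-root site the column is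
`stepScale·#B·(δ − δ) ≠ 0` in general), so the composite covariance row holds for comb-root lists whose storeys `k ≥ 1` are centred — `ρs (k+1) = ctrOff
(d+1) Lc` — with the top comb root `ρs 0` free (it only indexes the top block's columns).  This file proves exactly that (§3), the constant-list instance
`ρs := fun _ => ctrOff (d+1) Lc` the row's door files use (the OWNER d1-p3 g29 (6) #21-Sym; leaf-06 g32∕g33 G-1 §2 ∕ G-2 §2), and the top step's `d0`; the
universal-in-`ρs` display of `hc0` is NOT dischargeable for the centred kernel (leaf-02 g31 W-1, journal l.56632) — the displayed binder takes the extra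
clause `(∀ k, ρs (k+1) = ctrOff (d+1) Lc)` (§3 `compRowsSym_mul_towerGen_succ_of_centred`, binders in the display's order) or the constant list
(§3 `compRowsSym_mul_towerGen_succ`).

WHAT (generic `d`; blocking `Lc`, `[NeZero Lc]`; `hc : ctrOff (d+1) Lc ∈ box (d+1) Lc` displayed where a root SITE is read — met by `ctrOff_mem_box`).
* §1 **`QstepSym_mul_tgrad_mul`** — THE ONE-STEP SYM MASTER IDENTITY IN MATRIX FORM (g21's `perF_bhKStepSh_Dsh_mul_tgrad_sum` on the coarse slots):
  `QstepSym Lc M ℓ · (D_fine · C) = (stepScale·#B) • D_coarse · C∘rootPt hc` for ANY family `C` of gauge functions — the rooted `Qstep_mul_tgrad_mul`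
  VERBATIM with the evaluation points the CENTRED root sites `rootPt M Lc hc u = Lc•u + ρ_c` (`TorusCompositeCovariance.rootPt` at `r := ctrOff`).
* §2 **`compRowsSym_mul_tgrad_mul`** — THE COMPOSITE SYM MASTER IDENTITY at every depth, ANY root list `rs` (the rows ignore it): `compRowsSym … n ·
  (D_finest · C) = (∏ stepScale·#B) • D_M · C∘itRoot`, `itRoot Lc M (fun _ => ctrOff (d+1) Lc) (fun _ => hc) n` (the rooted iterated root map at the
  constant centred list).
* §3 (COV-m) ORDER 0: `blockInd_itRootAt` (the block indicator read at the iterated roots is the column selector — `quo_itRoot`, ANY column root `r₀`);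
  the one-step sym letters in `QstepSym` form — `QstepSym_mul_tgrad_res` ((C1), g21 `torus_sym_cov₁`), `QstepSym_mul_tgrad_res_of_eq ∕
  QstepSym_mul_fromCols_smul_tgrad_res_of_eq` (the same at a comb root `r = ctrOff` GIVEN PROPOSITIONALLY — the dependent column type `Res (toSite r)`
  handled by `subst`), `QstepSym_mul_tgradBlock_res` ((C2), g21 `torus_sym_cov₂`, any column root), `QstepSym_mul_fromCols`, `compRowsSym_mul_towerGen_one`,
  `compRowsSym_mul_towerGen_step`; **`compRowsSym_mul_towerGen_succ_of_centred (hc) : ∀ n M lev ρs, (∀ k, ρs (k+1) = ctrOff (d+1) Lc) →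
  compRowsSym Lc M lev ρs (n+1) * towerGen Lc M ρs (n+1) = fromCols (σ_{n+1} • tgrad M↾(fields × Res (toSite (ρs 0)))) 0`**, `σ_{n+1} = ∏_{i<n+1}
  stepScale d Lc (lev (i+1)) · #B` DISPLAYED (the rooted unit VERBATIM); **`compRowsSym_mul_towerGen_succ (hc) (n M lev)`** = the same at
  `ρs := fun _ => ctrOff (d+1) Lc` (the OWNER's (6) ∕ leaf-06's G-1 §2 ∕ G-2 §2 instantiation); **`QtopSym_mul_smul_tgrad_res`** — the top step's sym rows
  `(perF M (bhKStepSh d Lc (Dsh Lc) ℓ))↾((pμ′, inr mμ′) × fields)` KILL `σ • tgrad M↾(fields × Res (toSite (ctrOff (d+1) Lc)))` (`Lc ∣ M i`; g21's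
  `perF_bhKStepSh_Dsh_mul_tgrad_of_not_root`) = the OWNER's displayed `d0 : Q₂₀ * Dbar = 0` with `hQ₂₀ ∕ hDbar` as in (6) v1.1, BY `exact`.
NOT HERE: orders 1, 2 (`c1 c2 d1 d2` — the composite sym insertion jets `compIns₁Sym ∕ compIns₂₂Sym` by the product rule over R-18 ∕ R-19: the next
files of this lineage); the universal-in-`ρs` `hc0` (false for the centred kernel, see WHY); any chart; any estimate.

STYLE: the rooted file's proofs VERBATIM under `Qstep Lc M ℓ r ↦ QstepSym Lc M ℓ`, `perF_bhKStepAt_mul_tgrad_sum ↦ perF_bhKStepSh_Dsh_mul_tgrad_sum`,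
`torus_cov₁∕₂ ↦ torus_sym_cov₁∕₂`, `hrs k ↦ hc`; `ctr (d+1) Lc = toSite (ctrOff (d+1) Lc)` is `rfl`.  [folklore] finite sums ∕ integer division BY NAME
over OUR bookkeeping objects (`rootPt ∕ itRoot ∕ towerGen ∕ NParam ∕ Res ∕ tgrad ∕ tgradBlock`, leaf-06's `QstepSym ∕ compRowsSym`) and g21's sym one-step
letters; no `def`, no `def … : Prop`, nothing cited, 0 sorry, default heartbeats.  Nothing of the dictionary ∕ Bałaban's non-linear averages asserted
(that the re-based composite IS the record's (0.4)-symmetrised averaging is the ROW's (β1) ruling R-D1-g52-1, quoted, not adjudicated here); NO chart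
fixed; the (C1) TABLES, the seven letters, `hH ∕ hQ` untouched.

HONEST DEPENDENCY (page 1, mandatory): continuum YM on T⁴ ⇐ BetaPertH ∧ nine spine estimates (0/9 proved); BetaPertH ⇐ (D1) ∧ (D4) ∧ CAP+tail;
G-an2-4 gates asym, D1 and NE2/3/4.  HONEST FRAMING (cell contract, verbatim): «discharging `BetaPertH` makes Bałaban's UV stability UNCONDITIONAL —
a real constructive-QFT result; it is NOT the continuum limit and NOT the Clay problem.»  ABSOLUTE RULE (cell charter, verbatim): «No internally-minted
statement may enter as a cited fact. Every hypothesis is either kernel-proved in this package or a verbatim quotation of a PUBLISHED theorem with page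
reference. The manuscript(s) under audit are NOT citable for their own disputed steps — they are the thing under adjudication; programme-internal
(2001/route/tribunal) claims are never citable.»  0 estimates; 0∕4 row-D1 binders (hW, hR, D1Tel, D1Rep); NOT (T-ID), NOT (C1), NOT SDF, NOT D1,
NOT BetaPertH, NOT continuum, NOT Clay.  D1 formalisation swarm LEAF PROVER 02 (b2b-balaban-beta-d1-formalise-leaf-02 gen 32), 2026-08-24.  No existing file touched.
-/

noncomputable section

open scoped BigOperators

namespace Summit.QuantumFields.BalabanUV.Beta.FP.TorusCompositeCovarianceSym

open Matrix Finset
open Literature.Probability.LatticeModels (Torus.proj)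
open Literature.MathematicalPhysics.QuantumFieldTheory
open Literature.MathematicalPhysics.QuantumFieldTheory.Balaban1983to89
open Literature.MathematicalPhysics.QuantumFieldTheory.Balaban1983to89.Beta
open B5Prop11Plancherel (fine)
open B6Lemma24Torus (pbox mem_pbox)
open AffineAveraging (Site box toSite unitVec)
open AveragingContoursRooted (ctr ctrOff ctrOff_mem_box)
open LatticeForm (quo)
open OneStepResolventKernel (Fib)
open Summit.QuantumFields.BalabanUV.Beta.BorderedHessian (stepScale)
open Summit.QuantumFields.BalabanUV.Beta.SymShiftedSpread (bhKStepSh)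
open Summit.QuantumFields.BalabanUV.Beta.DshAn1 (Dsh)
open Summit.QuantumFields.BalabanUV.Beta.FP.KernelPeriodisationFib (Idx perF)
open Summit.QuantumFields.BalabanUV.Beta.FP.TorusGaugeCovariance (tdelta tgrad tgrad_inl tgrad_inr tdelta_of_mem)
open Summit.QuantumFields.BalabanUV.Beta.FP.TorusGaugeCovariancePairing (wrapPt wrapPt_coe wrapPt_of_mem sum_tdelta_mul)
open Summit.QuantumFields.BalabanUV.Beta.FP.TorusGaugeCovarianceCoarse (tgradBlock coarsePt coarsePt_coe proj_coarsePt)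
open Summit.QuantumFields.BalabanUV.Beta.FP.TorusCombRows (Res ne_rootOf_iff_proj_ne)
open Summit.QuantumFields.BalabanUV.Beta.GAN24.FineReadoutCauchyFrame (toSite_mem_range)
open Summit.QuantumFields.BalabanUV.Beta.FP.NestedStepLawTorusInstance (submatrix_field_mul)
open Summit.QuantumFields.BalabanUV.Beta.FP.TorusCompositeObjects
open Summit.QuantumFields.BalabanUV.Beta.FP.TorusCompositeObjectsG (QstepSym QSym compRowsSym compRowsSym_succ compRowsSym_one)
open Summit.QuantumFields.BalabanUV.Beta.FP.TorusCompositeCovariance (rootPt rootPt_coe wrapPt_coarsePt_add wrapPt_coarsePt_add_add itRoot itRoot_zero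
  itRoot_succ quo_itRoot towerGen_top_eq tgrad_mul_colSel)
open Summit.QuantumFields.BalabanUV.Beta.FP.TorusSymGaugeCovariance (perF_bhKStepSh_Dsh_mul_tgrad_sum perF_bhKStepSh_Dsh_mul_tgrad_of_not_root
  torus_sym_cov₁ torus_sym_cov₂)

variable {d : ℕ}

/-! ## §1 The one-step sym MASTER identity in matrix form (evaluation at the CENTRED root sites) -/

section OneStep

variable (M : Fin (d + 1) → ℕ) [∀ μ, NeZero (M μ)] (Lc : ℕ) [NeZero Lc]

/-- [folklore] **THE ONE-STEP SYM MASTER IDENTITY IN MATRIX FORM** (g21's `perF_bhKStepSh_Dsh_mul_tgrad_sum` on the coarse slots of leaf-06's `QstepSym`):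
the (0.4)-symmetrised averaging of the torus gradient of ANY family `C` of gauge functions is `stepScale·#B` times the COARSE gradient of the family READ AT
THE CENTRED ROOT SITES `rootPt M Lc hc u = Lc•u + ρ_c` — the rooted `Qstep_mul_tgrad_mul` at `r := ctrOff (d+1) Lc`, verbatim. -/
theorem QstepSym_mul_tgrad_mul (hc : ctrOff (d + 1) Lc ∈ box (d + 1) Lc) (ℓ : ℕ) {X : Type*} (C : Matrix ↥(pbox (fine Lc M)) X ℝ) :
    QstepSym Lc M ℓ * ((tgrad (fine Lc M)).submatrix (fun b : ↥(pbox (fine Lc M)) × Fin (d + 1) => ((b.1, Sum.inl b.2) : Idx (fine Lc M) (Fib d))) id * C)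
      = (stepScale d Lc ℓ * ((box (d + 1) Lc).card : ℝ)) •
          ((tgrad M).submatrix (fun a : ↥(pbox M) × Fin (d + 1) => ((a.1, Sum.inl a.2) : Idx M (Fib d))) id * C.submatrix (rootPt M Lc hc) id) := by
  ext a x
  rw [← Matrix.mul_assoc, QstepSym, submatrix_field_mul (fine Lc M) _ _ (tgrad_inr (fine Lc M)), Matrix.mul_apply, Matrix.smul_apply, Matrix.mul_apply]
  simp only [Matrix.submatrix_apply, id, Matrix.mul_apply]
  rw [perF_bhKStepSh_Dsh_mul_tgrad_sum (fine Lc M) ℓ (coarsePt M Lc a.1) a.2 (fun s => C s x), if_pos (proj_coarsePt M Lc a.1),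
    show ctr (d + 1) Lc = toSite (ctrOff (d + 1) Lc) from rfl, wrapPt_coarsePt_add_add M Lc hc, wrapPt_coarsePt_add M Lc hc]
  simp only [tgrad_inl, sub_mul, Finset.sum_sub_distrib, sum_tdelta_mul, wrapPt_of_mem, smul_eq_mul]
  ring

end OneStep

/-! ## §2 The COMPOSITE sym MASTER identity (the iterated root map at the constant centred list) -/

section Tower

variable (Lc : ℕ) [NeZero Lc]

/-- [folklore] the COMPOSITE sym MASTER identity, INDUCTION STEP (top peel `compRowsSym_succ`): the one-step sym MASTER on top of the identity below `fine Lc M`. -/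
theorem compRowsSym_mul_tgrad_mul_step (hc : ctrOff (d + 1) Lc ∈ box (d + 1) Lc) (n : ℕ) (M : Fin (d + 1) → ℕ) [∀ μ, NeZero (M μ)] (lev : ℕ → ℕ)
    (rs : ℕ → (Fin (d + 1) → ℕ)) {X : Type*} (C : Matrix ↥(pbox (towerTorus Lc (fine Lc M) n)) X ℝ)
    (ih : compRowsSym Lc (fine Lc M) (fun k => lev (k + 1)) (fun k => rs (k + 1)) n
        * ((tgrad (towerTorus Lc (fine Lc M) n)).submatrix
            (fun b : ↥(pbox (towerTorus Lc (fine Lc M) n)) × Fin (d + 1) => ((b.1, Sum.inl b.2) : Idx (towerTorus Lc (fine Lc M) n) (Fib d))) id * C)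
      = (∏ i ∈ range n, (stepScale d Lc (lev (i + 1 + 1)) * ((box (d + 1) Lc).card : ℝ))) •
          ((tgrad (fine Lc M)).submatrix (fun a : ↥(pbox (fine Lc M)) × Fin (d + 1) => ((a.1, Sum.inl a.2) : Idx (fine Lc M) (Fib d))) id
            * C.submatrix (itRoot Lc (fine Lc M) (fun _ => ctrOff (d + 1) Lc) (fun _ => hc) n) id)) :
    QstepSym Lc M (lev 1) * compRowsSym Lc (fine Lc M) (fun k => lev (k + 1)) (fun k => rs (k + 1)) n
        * ((tgrad (towerTorus Lc (fine Lc M) n)).submatrix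
            (fun b : ↥(pbox (towerTorus Lc (fine Lc M) n)) × Fin (d + 1) => ((b.1, Sum.inl b.2) : Idx (towerTorus Lc (fine Lc M) n) (Fib d))) id * C)
      = (∏ i ∈ range (n + 1), (stepScale d Lc (lev (i + 1)) * ((box (d + 1) Lc).card : ℝ))) •
          ((tgrad M).submatrix (fun a : ↥(pbox M) × Fin (d + 1) => ((a.1, Sum.inl a.2) : Idx M (Fib d))) id
            * C.submatrix (fun u => itRoot Lc (fine Lc M) (fun _ => ctrOff (d + 1) Lc) (fun _ => hc) n (rootPt M Lc hc u)) id) := by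
  rw [Matrix.mul_assoc, ih, Matrix.mul_smul, QstepSym_mul_tgrad_mul M Lc hc (lev 1), smul_smul, Matrix.submatrix_submatrix, prod_range_succ']
  rfl

/-- [folklore] **THE COMPOSITE SYM MASTER IDENTITY** (ANY comb-root list `rs` — `compRowsSym` ignores it): the `n`-fold (0.4)-symmetrised composite averaging of
the finest torus's gradient of ANY family `C` of gauge functions is `∏ (stepScale·#B)` times the TOP torus's gradient of the family READ AT THE ITERATED
CENTRED ROOT SITES `itRoot Lc M (fun _ => ctrOff (d+1) Lc) (fun _ => hc) n` (`QstepSym_mul_tgrad_mul` iterated down the tower). -/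
theorem compRowsSym_mul_tgrad_mul (hc : ctrOff (d + 1) Lc ∈ box (d + 1) Lc) :
    ∀ (n : ℕ) (M : Fin (d + 1) → ℕ) [∀ μ, NeZero (M μ)] (lev : ℕ → ℕ) (rs : ℕ → (Fin (d + 1) → ℕ))
      {X : Type*} (C : Matrix ↥(pbox (towerTorus Lc M n)) X ℝ),
      compRowsSym Lc M lev rs n
          * ((tgrad (towerTorus Lc M n)).submatrix
              (fun b : ↥(pbox (towerTorus Lc M n)) × Fin (d + 1) => ((b.1, Sum.inl b.2) : Idx (towerTorus Lc M n) (Fib d))) id * C)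
        = (∏ i ∈ range n, (stepScale d Lc (lev (i + 1)) * ((box (d + 1) Lc).card : ℝ))) •
            ((tgrad M).submatrix (fun a : ↥(pbox M) × Fin (d + 1) => ((a.1, Sum.inl a.2) : Idx M (Fib d))) id
              * C.submatrix (itRoot Lc M (fun _ => ctrOff (d + 1) Lc) (fun _ => hc) n) id)
  | 0, M, _, lev, rs, X, C => by
    dsimp only [towerTorus_zero] at C
    show (1 : Matrix (↥(pbox M) × Fin (d + 1)) (↥(pbox M) × Fin (d + 1)) ℝ) * ((tgrad M).submatrix (fun a : ↥(pbox M) × Fin (d + 1) => ((a.1, Sum.inl a.2) : Idx M (Fib d))) id * C)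
      = (∏ i ∈ range 0, (stepScale d Lc (lev (i + 1)) * ((box (d + 1) Lc).card : ℝ))) • ((tgrad M).submatrix (fun a : ↥(pbox M) × Fin (d + 1) => ((a.1, Sum.inl a.2) : Idx M (Fib d))) id * C.submatrix id id)
    rw [Matrix.one_mul, prod_range_zero, one_smul]
    rfl
  | n + 1, M, _, lev, rs, X, C =>
    compRowsSym_mul_tgrad_mul_step Lc hc n M lev rs C
      (compRowsSym_mul_tgrad_mul hc n (fine Lc M) (fun k => lev (k + 1)) (fun k => rs (k + 1)) C)

end Tower

/-! ## §3 (COV-m) ORDER 0 for the sym tower: `c0` at centred root lists, and the top step's `d0` -/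

section Covariance

variable (Lc : ℕ) [NeZero Lc]

/-- [folklore] **THE BLOCK INDICATOR READ AT THE ITERATED ROOTS IS THE COLUMN SELECTOR**, ANY root list for the sites, ANY column root `r₀` (`quo_itRoot`):
`[quo (Lc^{n+1}) (itRoot (rootPt u)) ≡ t] = [u = t]` — the rooted `blockInd_itRoot` is the case `r₀ = rs 0`. -/
theorem blockInd_itRootAt (M : Fin (d + 1) → ℕ) [∀ μ, NeZero (M μ)] (rs : ℕ → (Fin (d + 1) → ℕ)) (hrs : ∀ k, rs k ∈ box (d + 1) Lc)
    (r₀ : Fin (d + 1) → ℕ) (n : ℕ) :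
    (Matrix.of (fun (s : ↥(pbox (towerTorus Lc (fine Lc M) n))) (t : Res (toSite r₀) Lc M) =>
        tdelta M (quo (bigRatio Lc n) (s : Site (d + 1))) t.1)).submatrix
          (fun u => itRoot Lc (fine Lc M) (fun k => rs (k + 1)) (fun k => hrs (k + 1)) n (rootPt M Lc (hrs 1) u)) id
      = Matrix.of (fun (u : ↥(pbox M)) (t : Res (toSite r₀) Lc M) => if u = t.1 then (1 : ℝ) else 0) := by
  ext u t
  have h := quo_itRoot Lc (n + 1) M rs hrs u
  rw [itRoot_succ] at h
  dsimp only [towerTorus_succ] at h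
  simp only [Matrix.submatrix_apply, Matrix.of_apply, id]
  rw [bigRatio_eq_pow, h, tdelta_of_mem M u.2]
  simp only [Subtype.ext_iff]

/-- [folklore] the one-step sym (C1) in `QstepSym` form (g21 `torus_sym_cov₁`): the (0.4)-symmetrised averaging KILLS the fine torus's gauge modes at the residual
parameters of the CENTRED comb — `QstepSym · D₁ = 0` (`ctr (d+1) Lc = toSite (ctrOff (d+1) Lc)` by `rfl`). -/
theorem QstepSym_mul_tgrad_res (M : Fin (d + 1) → ℕ) [∀ μ, NeZero (M μ)] (ℓ : ℕ) :
    QstepSym Lc M ℓ * (tgrad (fine Lc M)).submatrix (fun b : ↥(pbox (fine Lc M)) × Fin (d + 1) => ((b.1, Sum.inl b.2) : Idx (fine Lc M) (Fib d)))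
        (fun t : Res (toSite (ctrOff (d + 1) Lc)) Lc (fine Lc M) => (t.1 : ↥(pbox (fine Lc M)))) = 0 :=
  torus_sym_cov₁ M ℓ

/-- [folklore] … the same at a comb root `r` centred PROPOSITIONALLY (`r = ctrOff (d+1) Lc`; the dependent column type `Res (toSite r)` by `subst`). -/
theorem QstepSym_mul_tgrad_res_of_eq (M : Fin (d + 1) → ℕ) [∀ μ, NeZero (M μ)] (ℓ : ℕ) {r : Fin (d + 1) → ℕ} (hr : r = ctrOff (d + 1) Lc) :
    QstepSym Lc M ℓ * (tgrad (fine Lc M)).submatrix (fun b : ↥(pbox (fine Lc M)) × Fin (d + 1) => ((b.1, Sum.inl b.2) : Idx (fine Lc M) (Fib d)))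
        (fun t : Res (toSite r) Lc (fine Lc M) => (t.1 : ↥(pbox (fine Lc M)))) = 0 := by
  subst hr
  exact QstepSym_mul_tgrad_res Lc M ℓ

/-- [folklore] (C1) against a LOWER tower's descended block `[σ • D̄′ | 0]` at a centred comb root: the sym averaging of `M ← fine Lc M` kills it entirely
(any scalar `σ`, any lower parameter type `Y`). -/
theorem QstepSym_mul_fromCols_smul_tgrad_res_of_eq (M : Fin (d + 1) → ℕ) [∀ μ, NeZero (M μ)] (ℓ : ℕ) {r : Fin (d + 1) → ℕ}
    (hr : r = ctrOff (d + 1) Lc) (σ : ℝ) (Y : Type*) :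
    QstepSym Lc M ℓ * Matrix.fromCols
        (σ • (tgrad (fine Lc M)).submatrix (fun b : ↥(pbox (fine Lc M)) × Fin (d + 1) => ((b.1, Sum.inl b.2) : Idx (fine Lc M) (Fib d)))
          (fun t : Res (toSite r) Lc (fine Lc M) => (t.1 : ↥(pbox (fine Lc M)))))
        (0 : Matrix (↥(pbox (fine Lc M)) × Fin (d + 1)) Y ℝ) = 0 := by
  rw [Matrix.mul_fromCols, Matrix.mul_smul, QstepSym_mul_tgrad_res_of_eq Lc M ℓ hr, smul_zero, Matrix.mul_zero, Matrix.fromCols_zero]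

/-- [folklore] the one-step sym (C2) in `QstepSym` form (g21 `torus_sym_cov₂`, MASTER-COARSE): the (0.4)-symmetrised averaging DESCENDS the block-constant
modes to `stepScale·#B` times the coarse torus's gradients — `QstepSym · D₂ = (stepScale·#B) • D̄`, ANY column root `r′`. -/
theorem QstepSym_mul_tgradBlock_res (M : Fin (d + 1) → ℕ) [∀ μ, NeZero (M μ)] (ℓ : ℕ) (r' : Fin (d + 1) → ℕ) :
    QstepSym Lc M ℓ * (tgradBlock M Lc).submatrix (fun b : ↥(pbox (fine Lc M)) × Fin (d + 1) => ((b.1, Sum.inl b.2) : Idx (fine Lc M) (Fib d)))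
        (fun t : Res (toSite r') Lc M => (t.1 : ↥(pbox M)))
      = (stepScale d Lc ℓ * ((box (d + 1) Lc).card : ℝ)) •
          (tgrad M).submatrix (fun a : ↥(pbox M) × Fin (d + 1) => ((a.1, Sum.inl a.2) : Idx M (Fib d))) (fun t : Res (toSite r') Lc M => (t.1 : ↥(pbox M))) := by
  ext a t
  have h := congrFun (congrFun (torus_sym_cov₂ M (Lc := Lc) ℓ (r' := r')) a) t
  rw [Matrix.of_apply] at h
  rw [Matrix.smul_apply, Matrix.submatrix_apply, smul_eq_mul]
  exact h.trans (by ring)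

/-- [folklore] **(COV-m) ORDER 0 AT DEPTH ONE, one-step sym form**: `QstepSym · [D₂ | D₁] = [(stepScale·#B) • D̄ | 0]` (`towerGen_one`'s blocks; top comb root
`ρs 0` free, storey-1 root centred). -/
theorem QstepSym_mul_fromCols (M : Fin (d + 1) → ℕ) [∀ μ, NeZero (M μ)] (lev : ℕ → ℕ) (ρs : ℕ → (Fin (d + 1) → ℕ)) (hρ : ρs 1 = ctrOff (d + 1) Lc) :
    QstepSym Lc M (lev 1) * Matrix.fromCols
        ((tgradBlock M Lc).submatrix (fun b : ↥(pbox (fine Lc M)) × Fin (d + 1) => ((b.1, Sum.inl b.2) : Idx (fine Lc M) (Fib d)))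
          (fun t : Res (toSite (ρs 0)) Lc M => (t.1 : ↥(pbox M))))
        ((tgrad (fine Lc M)).submatrix (fun b : ↥(pbox (fine Lc M)) × Fin (d + 1) => ((b.1, Sum.inl b.2) : Idx (fine Lc M) (Fib d)))
          (fun t : Res (toSite (ρs 1)) Lc (fine Lc M) => (t.1 : ↥(pbox (fine Lc M)))))
      = Matrix.fromCols
          ((∏ i ∈ range 1, (stepScale d Lc (lev (i + 1)) * ((box (d + 1) Lc).card : ℝ))) •
            (tgrad M).submatrix (fun a : ↥(pbox M) × Fin (d + 1) => ((a.1, Sum.inl a.2) : Idx M (Fib d))) (fun t : Res (toSite (ρs 0)) Lc M => (t.1 : ↥(pbox M))))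
          (0 : Matrix (↥(pbox M) × Fin (d + 1)) (Res (toSite (ρs 1)) Lc (fine Lc M)) ℝ) := by
  rw [Matrix.mul_fromCols, QstepSym_mul_tgradBlock_res Lc M (lev 1) (ρs 0), QstepSym_mul_tgrad_res_of_eq Lc M (lev 1) hρ, prod_range_one, zero_add]

/-- [folklore] **(COV-m) ORDER 0 AT DEPTH ONE** = the one-step sym `c0` (`compRowsSym_one ∕ towerGen_one`). -/
theorem compRowsSym_mul_towerGen_one (M : Fin (d + 1) → ℕ) [∀ μ, NeZero (M μ)] (lev : ℕ → ℕ) (ρs : ℕ → (Fin (d + 1) → ℕ))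
    (hρ : ρs 1 = ctrOff (d + 1) Lc) :
    compRowsSym Lc M lev ρs 1 * towerGen Lc M ρs 1
      = Matrix.fromCols
          ((∏ i ∈ range 1, (stepScale d Lc (lev (i + 1)) * ((box (d + 1) Lc).card : ℝ))) •
            (tgrad M).submatrix (fun a : ↥(pbox M) × Fin (d + 1) => ((a.1, Sum.inl a.2) : Idx M (Fib d))) (fun t : Res (toSite (ρs 0)) Lc M => (t.1 : ↥(pbox M))))
          (0 : Matrix (↥(pbox M) × Fin (d + 1)) (NParam Lc (fine Lc M) (fun k => ρs (k + 1)) 0) ℝ) := by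
  rw [compRowsSym_one]
  exact QstepSym_mul_fromCols Lc M lev ρs hρ

/-- [folklore] **(COV-m) ORDER 0, THE INDUCTION STEP** (top peel `compRowsSym_succ ∕ towerGen_succ`): if the `(n+1)`-fold sym composite below `fine Lc M` sends
its tower generators to `[σ′ • D̄′ | 0]` (`D̄′` at the storey-1 comb root `ρs 1 = ctrOff`), one more step on top gives `[σ′·stepScale(lev 1)·#B • D̄ | 0]` —
lower block: `QstepSym` kills `D̄′` ((C1) at the centred root); top block: the COMPOSITE sym MASTER identity against `towerGen_top_eq`, then the one-step sym
MASTER, `blockInd_itRootAt`, `tgrad_mul_colSel`. -/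
theorem compRowsSym_mul_towerGen_step (hc : ctrOff (d + 1) Lc ∈ box (d + 1) Lc) (n : ℕ) (M : Fin (d + 1) → ℕ) [∀ μ, NeZero (M μ)] (lev : ℕ → ℕ)
    (ρs : ℕ → (Fin (d + 1) → ℕ)) (hρ : ρs 1 = ctrOff (d + 1) Lc)
    (ih : compRowsSym Lc (fine Lc M) (fun k => lev (k + 1)) (fun k => ρs (k + 1)) (n + 1) * towerGen Lc (fine Lc M) (fun k => ρs (k + 1)) (n + 1)
      = Matrix.fromCols
          ((∏ i ∈ range (n + 1), (stepScale d Lc (lev (i + 1 + 1)) * ((box (d + 1) Lc).card : ℝ))) •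
            (tgrad (fine Lc M)).submatrix (fun a : ↥(pbox (fine Lc M)) × Fin (d + 1) => ((a.1, Sum.inl a.2) : Idx (fine Lc M) (Fib d)))
              (fun t : Res (toSite (ρs 1)) Lc (fine Lc M) => (t.1 : ↥(pbox (fine Lc M)))))
          (0 : Matrix (↥(pbox (fine Lc M)) × Fin (d + 1)) (NParam Lc (fine Lc (fine Lc M)) (fun k => ρs (k + 1 + 1)) n) ℝ)) :
    QstepSym Lc M (lev 1) * compRowsSym Lc (fine Lc M) (fun k => lev (k + 1)) (fun k => ρs (k + 1)) (n + 1)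
        * Matrix.fromCols
            ((tgradBlock M (bigRatio Lc (n + 1))).submatrix
              (fun b : ↥(pbox (towerTorus Lc (fine Lc M) (n + 1))) × Fin (d + 1) =>
                ((pboxCongr (towerTorus_fine_eq_fine Lc M (n + 1)) b.1, Sum.inl b.2) : Idx (fine (bigRatio Lc (n + 1)) M) (Fib d)))
              (fun t : Res (toSite (ρs 0)) Lc M => (t.1 : ↥(pbox M))))
            (towerGen Lc (fine Lc M) (fun k => ρs (k + 1)) (n + 1))
      = Matrix.fromCols
          ((∏ i ∈ range (n + 1 + 1), (stepScale d Lc (lev (i + 1)) * ((box (d + 1) Lc).card : ℝ))) •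
            (tgrad M).submatrix (fun a : ↥(pbox M) × Fin (d + 1) => ((a.1, Sum.inl a.2) : Idx M (Fib d))) (fun t : Res (toSite (ρs 0)) Lc M => (t.1 : ↥(pbox M))))
          (0 : Matrix (↥(pbox M) × Fin (d + 1)) (NParam Lc (fine Lc M) (fun k => ρs (k + 1)) (n + 1)) ℝ) := by
  have hσ : (∏ i ∈ range (n + 1), (stepScale d Lc (lev (i + 1 + 1)) * ((box (d + 1) Lc).card : ℝ))) * (stepScale d Lc (lev 1) * ((box (d + 1) Lc).card : ℝ))
      = ∏ i ∈ range (n + 1 + 1), (stepScale d Lc (lev (i + 1)) * ((box (d + 1) Lc).card : ℝ)) := by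
    rw [prod_range_succ' _ (n + 1)]
  -- the lower block: `QstepSym` kills the lower tower's descended modes at the centred storey-1 root (read `ih` through `QstepSym ·`)
  have low : QstepSym Lc M (lev 1)
      * (compRowsSym Lc (fine Lc M) (fun k => lev (k + 1)) (fun k => ρs (k + 1)) (n + 1) * towerGen Lc (fine Lc M) (fun k => ρs (k + 1)) (n + 1)) = 0 :=
    (congrArg (fun X => QstepSym Lc M (lev 1) * X) ih).trans
      (QstepSym_mul_fromCols_smul_tgrad_res_of_eq Lc M (lev 1) hρ _ (NParam Lc (fine Lc (fine Lc M)) (fun k => ρs (k + 1 + 1)) n))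
  have cm := compRowsSym_mul_tgrad_mul Lc hc (n + 1) (fine Lc M) (fun k => lev (k + 1)) (fun k => ρs (k + 1))
    (Matrix.of (fun (s : ↥(pbox (towerTorus Lc (fine Lc M) (n + 1)))) (t : Res (toSite (ρs 0)) Lc M) =>
      tdelta M (quo (bigRatio Lc (n + 1)) (s : Site (d + 1))) t.1))
  rw [Matrix.mul_assoc, Matrix.mul_fromCols, Matrix.mul_fromCols, low, towerGen_top_eq Lc M ρs (n + 1), cm, Matrix.mul_smul,
    QstepSym_mul_tgrad_mul M Lc hc (lev 1), smul_smul, Matrix.submatrix_submatrix, Function.comp_id, hσ]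
  rw [show (itRoot Lc (fine Lc M) (fun _ => ctrOff (d + 1) Lc) (fun _ => hc) (n + 1)) ∘ (rootPt M Lc hc)
      = fun u => itRoot Lc (fine Lc M) (fun _ => ctrOff (d + 1) Lc) (fun _ => hc) (n + 1) (rootPt M Lc hc u) from rfl,
    blockInd_itRootAt Lc M (fun _ => ctrOff (d + 1) Lc) (fun _ => hc) (ρs 0) (n + 1), tgrad_mul_colSel]

/-- [folklore] **(COV-m) ORDER 0 — THE SYM COMPOSITE COVARIANCE ROW `c0` AT EVERY DEPTH, CENTRED STOREYS, TOP COMB ROOT FREE**: for every comb-root list `ρs`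
with `ρs (k+1) = ctrOff (d+1) Lc`, the `(n+1)`-fold (0.4)-symmetrised composite averaging KILLS every lower level's gauge mode and DESCENDS the top
block-constant modes to `σ_{n+1} ×` the top torus's gradients at the top comb's residual parameters — `D̄ := tgrad M↾(fields × Res (toSite (ρs 0)))`,
`σ_{n+1} = ∏_{i ≤ n} stepScale d Lc (lev (i+1)) · #B` DISPLAYED (the rooted unit VERBATIM).  The displayed `hc0` binder of the `-Sym` door files with the ONE
extra clause `(∀ k, ρs (k+1) = ctrOff (d+1) Lc)`, binders in the display's order. -/
theorem compRowsSym_mul_towerGen_succ_of_centred (hc : ctrOff (d + 1) Lc ∈ box (d + 1) Lc) :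
    ∀ (n : ℕ) (M : Fin (d + 1) → ℕ) [∀ μ, NeZero (M μ)] (lev : ℕ → ℕ) (ρs : ℕ → (Fin (d + 1) → ℕ)), (∀ k, ρs (k + 1) = ctrOff (d + 1) Lc) →
      compRowsSym Lc M lev ρs (n + 1) * towerGen Lc M ρs (n + 1)
        = Matrix.fromCols
            ((∏ i ∈ range (n + 1), (stepScale d Lc (lev (i + 1)) * ((box (d + 1) Lc).card : ℝ))) •
              (tgrad M).submatrix (fun a : ↥(pbox M) × Fin (d + 1) => ((a.1, Sum.inl a.2) : Idx M (Fib d))) (fun t : Res (toSite (ρs 0)) Lc M => (t.1 : ↥(pbox M))))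
            (0 : Matrix (↥(pbox M) × Fin (d + 1)) (NParam Lc (fine Lc M) (fun k => ρs (k + 1)) n) ℝ)
  | 0, M, _, lev, ρs, hρ => compRowsSym_mul_towerGen_one Lc M lev ρs (hρ 0)
  | n + 1, M, _, lev, ρs, hρ =>
    compRowsSym_mul_towerGen_step Lc hc n M lev ρs (hρ 0)
      (compRowsSym_mul_towerGen_succ_of_centred hc n (fine Lc M) (fun k => lev (k + 1)) (fun k => ρs (k + 1)) (fun k => hρ (k + 1)))

/-- [folklore] **(COV-m) ORDER 0 — THE SYM COMPOSITE COVARIANCE ROW `c0` AT THE CONSTANT CENTRED ROOT LIST `fun _ => ctrOff (d+1) Lc`** (the record's list;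
the OWNER d1-p3's (6) #21-Sym and leaf-06's G-1 §2 ∕ G-2 §2 instantiation): `compRowsSym … (n+1) * towerGen … (n+1) = fromCols (σ_{n+1} • D̄) 0`,
`D̄ := tgrad M↾(fields × Res (toSite (ctrOff (d+1) Lc)))` — `compRowsSym_mul_towerGen_succ_of_centred` at the constant list (`fun _ => rfl`). -/
theorem compRowsSym_mul_towerGen_succ (hc : ctrOff (d + 1) Lc ∈ box (d + 1) Lc) (n : ℕ) (M : Fin (d + 1) → ℕ) [∀ μ, NeZero (M μ)] (lev : ℕ → ℕ) :
    compRowsSym Lc M lev (fun _ => ctrOff (d + 1) Lc) (n + 1) * towerGen Lc M (fun _ => ctrOff (d + 1) Lc) (n + 1)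
      = Matrix.fromCols
          ((∏ i ∈ range (n + 1), (stepScale d Lc (lev (i + 1)) * ((box (d + 1) Lc).card : ℝ))) •
            (tgrad M).submatrix (fun a : ↥(pbox M) × Fin (d + 1) => ((a.1, Sum.inl a.2) : Idx M (Fib d)))
              (fun t : Res (toSite (ctrOff (d + 1) Lc)) Lc M => (t.1 : ↥(pbox M))))
          (0 : Matrix (↥(pbox M) × Fin (d + 1)) (NParam Lc (fine Lc M) (fun _ => ctrOff (d + 1) Lc) n) ℝ) :=
  compRowsSym_mul_towerGen_succ_of_centred Lc hc n M lev (fun _ => ctrOff (d + 1) Lc) (fun _ => rfl)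

/-- [folklore] **(COV-m) ORDER 0 — THE TOP STEP's SYM COARSE COVARIANCE ROW `d0`**: the top step's (0.4)-symmetrised averaging rows (level `ℓ`, coarse multiplier
slots `a ↦ (pμ′ a, inr (mμ′ a))` of `M`) KILL `σ • D̄` at the residual parameters of the CENTRED comb ((C1) one level up, g21's
`perF_bhKStepSh_Dsh_mul_tgrad_of_not_root ∕ torus_sym_cov₀'` shape; any `σ`; `Lc ∣ M i`) — the OWNER's displayed `d0 : Q₂₀ * Dbar = 0` with `hQ₂₀ ∕ hDbar`
as in (6) #21-Sym v1.1, `Dbar := σ_{n+1} • D̄`. -/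
theorem QtopSym_mul_smul_tgrad_res (M : Fin (d + 1) → ℕ) [∀ μ, NeZero (M μ)] (hM : ∀ i, Lc ∣ M i) (ℓ : ℕ) (σ : ℝ) {κ : Type*}
    (pμ' : κ → ↥(pbox M)) (mμ' : κ → Fin (d + 1)) :
    (perF M (bhKStepSh d Lc (Dsh Lc) ℓ)).submatrix (fun a : κ => ((pμ' a, Sum.inr (mμ' a)) : Idx M (Fib d)))
          (fun b : ↥(pbox M) × Fin (d + 1) => ((b.1, Sum.inl b.2) : Idx M (Fib d)))
        * (σ • (tgrad M).submatrix (fun a : ↥(pbox M) × Fin (d + 1) => ((a.1, Sum.inl a.2) : Idx M (Fib d)))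
            (fun t : Res (toSite (ctrOff (d + 1) Lc)) Lc M => (t.1 : ↥(pbox M)))) = 0 := by
  have hLc : 0 < Lc := Nat.pos_of_ne_zero (NeZero.ne Lc)
  have hLc1 : 1 ≤ Lc := hLc
  rw [Matrix.mul_smul, submatrix_field_mul M _ _ (tgrad_inr M)]
  convert smul_zero σ
  ext a t
  rw [Matrix.submatrix_apply, Matrix.mul_apply, Matrix.zero_apply]
  exact perF_bhKStepSh_Dsh_mul_tgrad_of_not_root M hM ℓ _ (mμ' a)
    ((ne_rootOf_iff_proj_ne hLc (toSite_mem_range (ctrOff_mem_box hLc1)) _).1 t.2)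

end Covariance

end Summit.QuantumFields.BalabanUV.Beta.FP.TorusCompositeCovarianceSym

end
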